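/-
Origin: expansion seat `prover-pub-hodgecm-mc-binder-2-g14-0`, handover #S4 2026-08-20T12:17Z md5 da76d113549f (PKG a12cc0b030c8 → da76d113549f; 379 l.; σ implicit; proofs verbatim) (`HOME/mc/pub-hodgecm-mc-binder-2/g14/s5b/HodgeCM/Model/HypCensus/DensePlaceRange.lean`, md5 da76d113549f, 379 lines);
landed by the gen-20 packager (p-g20) in gate run 51 REPLACES the earlier landed copy of `HodgeCM/Model/HypCensus/DensePlaceRange.lean` (seat copy carried the packager Origin header of an earlier run (stripped)).
-/
/-
Copyright (c) 2026. All rights reserved.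
Released under Apache 2.0 license as described in the file LICENSE.
-/
import Summits.HodgeConjecture.HodgeCM.Model.HypCensus.DensePlace
import Summits.HodgeConjecture.HodgeCM.Model.HypCensus.DenseSlotSigmaNeg
import Summits.HodgeConjecture.HodgeCM.Model.HypCensus.DenseSlotIotaNeg

/-!
# (J-dense), step (iv-b) at the pin: per place, the letter eigenspace IS the range of the printed embedding

Binder-2 lineage, rows 18/19 (`hyp12`/`hyp34`), field `dense` of `HypCoreW`.

#63 (`DensePlace`) reduced the `K_∞`-isotypic polynomials of the pin to sums of place products of PER-PLACE joint eigenvectors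
`p_w ∈ ℂ[Fin 6]` of the letter substitutions `pinPlaceOp V S w` (eigenvalues `pinPlaceEig V S w`: `1` off `w(ι₁)`, `dVIota` at `w(ι₁)`).
This leaf identifies, place by place, that joint eigenspace with the range of the printed embedding `embOf … (datumAt …) b` of the
chosen place data (#27/#29), by transporting #20 / #64 (`Σ₁₂`, both `V`-readings), #65 (`D₁₂`), #66 / #67 (`ι₁`, both `W`-readings)
through the place frame `pairFrame` (#32 `linSubst_star_reindexUnitary_rename`, #36 `cmIdx_eq_pairFrame`):

* §1 datum level: `mem_range_emb_of_eq_iota/_of_eq_sigmaPos/_of_eq_sigmaNeg`, `C_mem_range_emb_of_kind_delta`;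
* §2 `dVIota_eq_det_of_pos/_of_neg`, `dVIota_one`, `pinPlaceEig_of_ne`; the transport `linSubst_dualPairι_framePoly`;
* §3 **`mem_range_embOf_of_mem_jointEigenspace`**: for every real place `w` and every
  `p ∈ jointEigenspace (pinPlaceOp V S w ·) (pinPlaceEig V S w)`, `p ∈ range (embOf … (datumAtσ V S jD (jIOf V S hW) σ) m₁ m₂ ((cmPlacesEquiv L).symm w))`.

[GoodmanWallach2009 §4.2.1, §5.2.1; KashiwaraVergne1978 Ch. III §5; folklore]  Nothing here is a claim of PerL/QW8.
-/

noncomputable section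

open NumberField NumberField.InfinitePlace IsDedekindDomain
open scoped Matrix Classical TensorProduct
open MvPolynomial
open Literature.NumberTheory.Automorphic Literature.NumberTheory.Automorphic.UnitaryGroup Literature.NumberTheory.Weil1964
open Literature.RepresentationTheory.KonnoKonno2007 Literature.RepresentationTheory.KonnoKonno2007.RealDualPair
open Literature.NumberTheory.GelbartRogawski1991 Literature.NumberTheory.GelbartRogawski1991.UnitaryDualPair
open Literature.Analysis.SegalBargmann Literature.RepresentationTheory
open HodgeCM HodgeCM.Model
open HodgeCM.PerL34.Fock HodgeCM.PerL34.Fock.PrintDict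

namespace HodgeCM.Model.HypCensus

/-! ## §1 Datum level: the ranges of the printed embeddings -/

section Datum

variable (L : Type) [Field L] [NumberField L] [IsCMField L]
variable (dV : Fin 3 → L) (hdV : ∀ i, IsCMField.complexConj L (dV i) = dV i)
variable (dW : Fin 2 → L) (hdW : ∀ i, IsCMField.complexConj L (dW i) = dW i) (ι₁ : L →+* ℂ)
variable (v : {v : InfinitePlace ↥(maximalRealSubfield L) // v.IsReal})

/-- **ι₁ datum**: every multiple of `rename jI (det z)` is an embedded printed vector. -/
theorem mem_range_emb_of_eq_iota (jI : HodgeCM.PerL34.Fock.PlaneVar → Fin 6) :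
    ∀ (d : PlaceDatum L dV hdV dW hdW ι₁ v), d = PlaceDatum.iota jI → ∀ (vac : Circle × Circle →* Circle) (p : MvPolynomial (Fin 6) ℂ),
      p ∈ Submodule.span ℂ ({rename jI HodgeCM.PerL34.Fock.detZ} : Set (MvPolynomial (Fin 6) ℂ)) → p ∈ LinearMap.range (d.emb vac) := by
  rintro d rfl vac p hp
  obtain ⟨c, rfl⟩ := Submodule.mem_span_singleton.mp hp
  refine ⟨c • ⟨HodgeCM.PerL34.Fock.detZ, Submodule.mem_span_singleton_self _⟩, ?_⟩
  rw [map_smul]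
  rfl

/-- **Σ₁₂ datum, `V` read positive**: every element of `span {rename idx (P^k)}` is an embedded printed vector. -/
theorem mem_range_emb_of_eq_sigmaPos (eA : Fin 3 ≃ PosIdx (cmXV L dV hdV ι₁ v)) (hQ : IsEmpty (NegIdx (cmXV L dV hdV ι₁ v)))
    (r₀ : PosIdx (cmXW L dV dW hdW ι₁ v)) (s₀ : NegIdx (cmXW L dV dW hdW ι₁ v))
    (hR : Subsingleton (PosIdx (cmXW L dV dW hdW ι₁ v))) (hS : Subsingleton (NegIdx (cmXW L dV dW hdW ι₁ v))) :
    ∀ (d : PlaceDatum L dV hdV dW hdW ι₁ v), d = PlaceDatum.sigmaPos eA hQ r₀ s₀ hR hS → ∀ (vac : Circle × Circle →* Circle)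
      (p : MvPolynomial (Fin 6) ℂ),
      p ∈ Submodule.span ℂ (Set.range fun k : ℕ =>
        rename (PlaceDatum.sigmaPos eA hQ r₀ s₀ hR hS : PlaceDatum L dV hdV dW hdW ι₁ v).idx (HodgeCM.PerL34.Fock.P ^ k)) →
      p ∈ LinearMap.range (d.emb vac) := by
  rintro d rfl vac p hp
  have hsub : Submodule.span ℂ (Set.range fun k : ℕ =>
      rename (PlaceDatum.sigmaPos eA hQ r₀ s₀ hR hS : PlaceDatum L dV hdV dW hdW ι₁ v).idx (HodgeCM.PerL34.Fock.P ^ k)) ≤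
      LinearMap.range ((PlaceDatum.sigmaPos eA hQ r₀ s₀ hR hS : PlaceDatum L dV hdV dW hdW ι₁ v).emb vac) := by
    rw [Submodule.span_le]
    rintro _ ⟨k, rfl⟩
    exact ⟨⟨HodgeCM.PerL34.Fock.P ^ k, P_pow_mem_kappaPartM k⟩, rfl⟩
  exact hsub hp

/-- **Σ₁₂ datum, `V` read negative**: the same. -/
theorem mem_range_emb_of_eq_sigmaNeg (eA : Fin 3 ≃ NegIdx (cmXV L dV hdV ι₁ v)) (hP0 : IsEmpty (PosIdx (cmXV L dV hdV ι₁ v)))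
    (r₀ : PosIdx (cmXW L dV dW hdW ι₁ v)) (s₀ : NegIdx (cmXW L dV dW hdW ι₁ v))
    (hR : Subsingleton (PosIdx (cmXW L dV dW hdW ι₁ v))) (hS : Subsingleton (NegIdx (cmXW L dV dW hdW ι₁ v))) :
    ∀ (d : PlaceDatum L dV hdV dW hdW ι₁ v), d = PlaceDatum.sigmaNeg eA hP0 r₀ s₀ hR hS → ∀ (vac : Circle × Circle →* Circle)
      (p : MvPolynomial (Fin 6) ℂ),
      p ∈ Submodule.span ℂ (Set.range fun k : ℕ =>
        rename (PlaceDatum.sigmaNeg eA hP0 r₀ s₀ hR hS : PlaceDatum L dV hdV dW hdW ι₁ v).idx (HodgeCM.PerL34.Fock.P ^ k)) →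
      p ∈ LinearMap.range (d.emb vac) := by
  rintro d rfl vac p hp
  have hsub : Submodule.span ℂ (Set.range fun k : ℕ =>
      rename (PlaceDatum.sigmaNeg eA hP0 r₀ s₀ hR hS : PlaceDatum L dV hdV dW hdW ι₁ v).idx (HodgeCM.PerL34.Fock.P ^ k)) ≤
      LinearMap.range ((PlaceDatum.sigmaNeg eA hP0 r₀ s₀ hR hS : PlaceDatum L dV hdV dW hdW ι₁ v).emb vac) := by
    rw [Submodule.span_le]
    rintro _ ⟨k, rfl⟩
    exact ⟨⟨HodgeCM.PerL34.Fock.P ^ k, P_pow_mem_kappaPartM k⟩, rfl⟩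
  exact hsub hp

/-- **Σ₁₂ datum, `V` read positive, SWAPPED printed orientation (T12)**: the same. -/
theorem mem_range_emb_of_eq_sigmaPosSwap (eA : Fin 3 ≃ PosIdx (cmXV L dV hdV ι₁ v)) (hQ : IsEmpty (NegIdx (cmXV L dV hdV ι₁ v)))
    (r₀ : PosIdx (cmXW L dV dW hdW ι₁ v)) (s₀ : NegIdx (cmXW L dV dW hdW ι₁ v))
    (hR : Subsingleton (PosIdx (cmXW L dV dW hdW ι₁ v))) (hS : Subsingleton (NegIdx (cmXW L dV dW hdW ι₁ v))) :
    ∀ (d : PlaceDatum L dV hdV dW hdW ι₁ v), d = PlaceDatum.sigmaPosSwap eA hQ r₀ s₀ hR hS → ∀ (vac : Circle × Circle →* Circle)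
      (p : MvPolynomial (Fin 6) ℂ),
      p ∈ Submodule.span ℂ (Set.range fun k : ℕ =>
        rename (PlaceDatum.sigmaPosSwap eA hQ r₀ s₀ hR hS : PlaceDatum L dV hdV dW hdW ι₁ v).idx (HodgeCM.PerL34.Fock.P ^ k)) →
      p ∈ LinearMap.range (d.emb vac) := by
  rintro d rfl vac p hp
  have hsub : Submodule.span ℂ (Set.range fun k : ℕ =>
      rename (PlaceDatum.sigmaPosSwap eA hQ r₀ s₀ hR hS : PlaceDatum L dV hdV dW hdW ι₁ v).idx (HodgeCM.PerL34.Fock.P ^ k)) ≤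
      LinearMap.range ((PlaceDatum.sigmaPosSwap eA hQ r₀ s₀ hR hS : PlaceDatum L dV hdV dW hdW ι₁ v).emb vac) := by
    rw [Submodule.span_le]
    rintro _ ⟨k, rfl⟩
    exact ⟨⟨HodgeCM.PerL34.Fock.P ^ k, P_pow_mem_kappaPartM k⟩, rfl⟩
  exact hsub hp

/-- **Σ₁₂ datum, `V` read negative, SWAPPED printed orientation (T12)**: the same. -/
theorem mem_range_emb_of_eq_sigmaNegSwap (eA : Fin 3 ≃ NegIdx (cmXV L dV hdV ι₁ v)) (hP0 : IsEmpty (PosIdx (cmXV L dV hdV ι₁ v)))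
    (r₀ : PosIdx (cmXW L dV dW hdW ι₁ v)) (s₀ : NegIdx (cmXW L dV dW hdW ι₁ v))
    (hR : Subsingleton (PosIdx (cmXW L dV dW hdW ι₁ v))) (hS : Subsingleton (NegIdx (cmXW L dV dW hdW ι₁ v))) :
    ∀ (d : PlaceDatum L dV hdV dW hdW ι₁ v), d = PlaceDatum.sigmaNegSwap eA hP0 r₀ s₀ hR hS → ∀ (vac : Circle × Circle →* Circle)
      (p : MvPolynomial (Fin 6) ℂ),
      p ∈ Submodule.span ℂ (Set.range fun k : ℕ =>
        rename (PlaceDatum.sigmaNegSwap eA hP0 r₀ s₀ hR hS : PlaceDatum L dV hdV dW hdW ι₁ v).idx (HodgeCM.PerL34.Fock.P ^ k)) →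
      p ∈ LinearMap.range (d.emb vac) := by
  rintro d rfl vac p hp
  have hsub : Submodule.span ℂ (Set.range fun k : ℕ =>
      rename (PlaceDatum.sigmaNegSwap eA hP0 r₀ s₀ hR hS : PlaceDatum L dV hdV dW hdW ι₁ v).idx (HodgeCM.PerL34.Fock.P ^ k)) ≤
      LinearMap.range ((PlaceDatum.sigmaNegSwap eA hP0 r₀ s₀ hR hS : PlaceDatum L dV hdV dW hdW ι₁ v).emb vac) := by
    rw [Submodule.span_le]
    rintro _ ⟨k, rfl⟩
    exact ⟨⟨HodgeCM.PerL34.Fock.P ^ k, P_pow_mem_kappaPartM k⟩, rfl⟩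
  exact hsub hp

/-- model level: the constants are embedded printed `D₁₂`-vectors. -/
theorem C_mem_range_rename_kindIncl_delta (lam : ℂ) (hlam : lam ≠ 0) (vac : Circle × Circle →* Circle) :
    ∀ (k : PlaceKind), k = .delta → ∀ (idx : KindVar k → Fin 6) (c : ℂ),
      C c ∈ LinearMap.range ((rename idx).toLinearMap ∘ₗ kindIncl lam hlam vac k)
  | .delta, _, idx, c => by
    refine ⟨c • ⟨1, Submodule.mem_span_singleton_self _⟩, ?_⟩
    rw [map_smul]
    change c • rename idx (kappaPartE.subtype ⟨1, _⟩) = C c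
    rw [Submodule.subtype_apply, map_one, smul_eq_C_mul, mul_one]
  | .sigma, h, _, _ => absurd h PlaceKind.noConfusion
  | .iota, h, _, _ => absurd h PlaceKind.noConfusion
  | .sigmaSwap, h, _, _ => absurd h PlaceKind.noConfusion

/-- **D₁₂ datum**: the constants are embedded printed vectors. -/
theorem C_mem_range_emb_of_kind_delta (d : PlaceDatum L dV hdV dW hdW ι₁ v) (hd : d.kind = .delta) (vac : Circle × Circle →* Circle)
    (c : ℂ) : C c ∈ LinearMap.range (d.emb vac) :=
  C_mem_range_rename_kindIncl_delta d.lam d.lam_ne_zero vac d.kind hd d.idx c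

end Datum

/-! ## §2 Pin level: the `ι₁` scalar, the place eigenvalues, the frame transport -/

section Pin

variable {L : CMField} {ι₁ : L →+* ℂ} (V : HermSpace3 L ι₁) (S : StubTree.SeesawDatum L)

/-- the place frame of the pin at `w` (`Fin 6 ≃` Konno–Konno's block index). -/
abbrev pinPairFrame (w : {v : InfinitePlace ↥(maximalRealSubfield L) // v.IsReal}) :
    Fin 6 ≃ DPIdx (PosIdx (cmXV (L : Type) (frameD V) (frameD_real V) ι₁ w)) (NegIdx (cmXV (L : Type) (frameD V) (frameD_real V) ι₁ w))
      (PosIdx (cmXW (L : Type) (frameD V) (dW S) (dW_real S) ι₁ w)) (NegIdx (cmXW (L : Type) (frameD V) (dW S) (dW_real S) ι₁ w)) :=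
  pairFrame (PosIdx (cmXV (L : Type) (frameD V) (frameD_real V) ι₁ w)) (NegIdx (cmXV (L : Type) (frameD V) (frameD_real V) ι₁ w))
    (PosIdx (cmXW (L : Type) (frameD V) (dW S) (dW_real S) ι₁ w)) (NegIdx (cmXW (L : Type) (frameD V) (dW S) (dW_real S) ι₁ w))
    finProdFinEquiv (cmEpsV (L : Type) (frameD V) (frameD_real V) ι₁ w) (cmEpsW (L : Type) (frameD V) (dW S) (dW_real S) ι₁ w)

/-- `dVIota` in the positive `W`-reading is `det (vcMatrix iotaFrameA A)`. -/
theorem dVIota_eq_det_of_pos (hR : ∀ j, 0 < cmXW (L : Type) (frameD V) (dW S) (dW_real S) ι₁ (cmPlace (L : Type) ι₁) j)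
    (a : Matrix.unitaryGroup (PosIdx (cmXV (L : Type) (frameD V) (frameD_real V) ι₁ (cmPlace (L : Type) ι₁))) ℂ ×
      Matrix.unitaryGroup (NegIdx (cmXV (L : Type) (frameD V) (frameD_real V) ι₁ (cmPlace (L : Type) ι₁))) ℂ) :
    dVIota V S a = (vcMatrix (iotaFrameA (L : Type) (frameD V) (frameD_real V) ι₁ (frameD_sign_ι₁ V)) (a.1 : Matrix _ _ ℂ)).det := by
  unfold dVIota
  rw [if_pos hR]
  rfl

/-- `dVIota` in the negative `W`-reading is `det ((vcMatrix iotaFrameA A)̄)`. -/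
theorem dVIota_eq_det_of_neg (hR : ¬ ∀ j, 0 < cmXW (L : Type) (frameD V) (dW S) (dW_real S) ι₁ (cmPlace (L : Type) ι₁) j)
    (a : Matrix.unitaryGroup (PosIdx (cmXV (L : Type) (frameD V) (frameD_real V) ι₁ (cmPlace (L : Type) ι₁))) ℂ ×
      Matrix.unitaryGroup (NegIdx (cmXV (L : Type) (frameD V) (frameD_real V) ι₁ (cmPlace (L : Type) ι₁))) ℂ) :
    dVIota V S a =
      ((vcMatrix (iotaFrameA (L : Type) (frameD V) (frameD_real V) ι₁ (frameD_sign_ι₁ V)) (a.1 : Matrix _ _ ℂ)).map star).det := by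
  unfold dVIota
  rw [if_neg hR]
  rfl

/-- the `ι₁` scalar of the trivial letter is `1`. -/
theorem dVIota_one : dVIota V S 1 = 1 := by
  by_cases hR : ∀ j, 0 < cmXW (L : Type) (frameD V) (dW S) (dW_real S) ι₁ (cmPlace (L : Type) ι₁) j
  · rw [dVIota_eq_det_of_pos V S hR]
    change (vcMatrix _ (1 : Matrix _ _ ℂ)).det = 1
    rw [vcMatrix_one', Matrix.det_one]
  · rw [dVIota_eq_det_of_neg V S hR]
    change ((vcMatrix _ (1 : Matrix _ _ ℂ)).map star).det = 1
    rw [map_star_vcMatrix_one, Matrix.det_one]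

/-- off the place under `ι₁` every place eigenvalue of the pin is `1`. -/
theorem pinPlaceEig_of_ne (w : {v : InfinitePlace ↥(maximalRealSubfield L) // v.IsReal}) (hw : w ≠ cmPlace (L : Type) ι₁)
    (a : VLetterFam V) : pinPlaceEig V S w a = 1 := by
  unfold pinPlaceEig
  rw [Pi.mulSingle_eq_of_ne (Ne.symm hw)]
  exact dVIota_one V S

/-- at the place under `ι₁` the place eigenvalue is `dVIota` of the letter. -/
theorem pinPlaceEig_cmPlace (a : VLetterFam V) : pinPlaceEig V S (cmPlace (L : Type) ι₁) a = dVIota V S (a (cmPlace (L : Type) ι₁)) := by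
  unfold pinPlaceEig
  rw [Pi.mulSingle_eq_same]

/-- **frame transport**: a joint eigenvector of the pin's place-`w` letters, read in the block index of `w`, is an eigenvector of
Konno–Konno's letter `dualPairι (x, (1,1))` with the pin eigenvalue. -/
theorem linSubst_dualPairι_framePoly (w : {v : InfinitePlace ↥(maximalRealSubfield L) // v.IsReal}) {p : MvPolynomial (Fin 6) ℂ}
    (hp : p ∈ jointEigenspace (fun a : VLetterFam V => (pinPlaceOp V S w a).toLinearMap) (pinPlaceEig V S w))
    (x : Matrix.unitaryGroup (PosIdx (cmXV (L : Type) (frameD V) (frameD_real V) ι₁ w)) ℂ ×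
      Matrix.unitaryGroup (NegIdx (cmXV (L : Type) (frameD V) (frameD_real V) ι₁ w)) ℂ) :
    linSubst (star ((dualPairι ((x, (1, 1)) : DPK (PosIdx (cmXV (L : Type) (frameD V) (frameD_real V) ι₁ w))
        (NegIdx (cmXV (L : Type) (frameD V) (frameD_real V) ι₁ w)) (PosIdx (cmXW (L : Type) (frameD V) (dW S) (dW_real S) ι₁ w))
        (NegIdx (cmXW (L : Type) (frameD V) (dW S) (dW_real S) ι₁ w))) : Matrix.unitaryGroup _ ℂ) : Matrix _ _ ℂ))
        (rename (pinPairFrame V S w) p) =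
      dVIota V S ((Pi.mulSingle w x : VLetterFam V) (cmPlace (L : Type) ι₁)) • rename (pinPairFrame V S w) p := by
  have h := mem_jointEigenspace.mp hp (Pi.mulSingle w x)
  simp only [AlgHom.toLinearMap_apply, pinPlaceOp, pinPlaceEig, Pi.mulSingle_eq_same] at h
  rw [localLetterBlock_apply] at h
  have hp' : p = rename (pinPairFrame V S w).symm (rename (pinPairFrame V S w) p) := by
    rw [rename_rename, Equiv.symm_comp_self, rename_id, AlgHom.id_apply]
  rw [hp', linSubst_star_reindexUnitary_rename, ← map_smul] at h
  exact rename_injective _ (pinPairFrame V S w).symm.injective h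

end Pin

/-! ## §3 Per place: the letter eigenspace lies in the range of the printed embedding -/

section Range

variable {L : CMField} {ι₁ : L →+* ℂ} (V : HermSpace3 L ι₁) (S : StubTree.SeesawDatum L)
variable (hW : (∀ j, 0 < (ι₁ ((dW S) j)).re) ∨ ∀ j, (ι₁ ((dW S) j)).re < 0)
variable (jD : InfinitePlace (L : Type) → HodgeCM.PerL34.Fock.EqVar → Fin 6) (m₁ m₂ : InfinitePlace (L : Type) → ℤ)
variable {σ : InfinitePlace (L : Type) → Equiv.Perm (Fin 2)}

/-- a polynomial of the pin read back from the block index of `w`. -/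
theorem eq_rename_symm_rename (w : {v : InfinitePlace ↥(maximalRealSubfield L) // v.IsReal}) (p : MvPolynomial (Fin 6) ℂ) :
    p = rename (pinPairFrame V S w).symm (rename (pinPairFrame V S w) p) := by
  rw [rename_rename, Equiv.symm_comp_self, rename_id, AlgHom.id_apply]

/-- **the place under `ι₁`.** -/
theorem mem_range_embOf_of_eq (b : InfinitePlace (L : Type)) (hb : cmPlacesEquiv (L : Type) b = cmPlace (L : Type) ι₁)
    {p : MvPolynomial (Fin 6) ℂ}
    (hp : p ∈ jointEigenspace (fun a : VLetterFam V => (pinPlaceOp V S (cmPlacesEquiv (L : Type) b) a).toLinearMap)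
      (pinPlaceEig V S (cmPlacesEquiv (L : Type) b))) :
    p ∈ LinearMap.range (embOf (L : Type) (frameD V) (frameD_real V) (dW S) (dW_real S) ι₁ (datumAtσ V S jD (jIOf V S hW) σ) m₁ m₂ b) := by
  rw [hb] at hp
  have hx : ∀ (A : Matrix.unitaryGroup (PosIdx (cmXV (L : Type) (frameD V) (frameD_real V) ι₁ (cmPlace (L : Type) ι₁))) ℂ)
      (D : Matrix.unitaryGroup (NegIdx (cmXV (L : Type) (frameD V) (frameD_real V) ι₁ (cmPlace (L : Type) ι₁))) ℂ),
      linSubst (star ((dualPairι (((A, D), (1, 1)) : DPK (PosIdx (cmXV (L : Type) (frameD V) (frameD_real V) ι₁ (cmPlace (L : Type) ι₁)))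
          (NegIdx (cmXV (L : Type) (frameD V) (frameD_real V) ι₁ (cmPlace (L : Type) ι₁)))
          (PosIdx (cmXW (L : Type) (frameD V) (dW S) (dW_real S) ι₁ (cmPlace (L : Type) ι₁)))
          (NegIdx (cmXW (L : Type) (frameD V) (dW S) (dW_real S) ι₁ (cmPlace (L : Type) ι₁)))) : Matrix.unitaryGroup _ ℂ) : Matrix _ _ ℂ))
          (rename (pinPairFrame V S (cmPlace (L : Type) ι₁)) p) =
        dVIota V S (A, D) • rename (pinPairFrame V S (cmPlace (L : Type) ι₁)) p := fun A D => by
    have := linSubst_dualPairι_framePoly V S (cmPlace (L : Type) ι₁) hp (A, D)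
    rwa [Pi.mulSingle_eq_same] at this
  have hι : datumAtσ V S jD (jIOf V S hW) σ b =
      PlaceDatum.iota (jIAt (L : Type) (frameD V) (frameD_real V) (dW S) (dW_real S) ι₁ (frameD_sign_ι₁ V) hW) :=
    datumAt_of_eq V S jD (jIOf V S hW) b hb
  refine mem_range_emb_of_eq_iota (L : Type) (frameD V) (frameD_real V) (dW S) (dW_real S) ι₁ _ _ _ hι _ p ?_
  by_cases hR : ∀ j, 0 < cmXW (L : Type) (frameD V) (dW S) (dW_real S) ι₁ (cmPlace (L : Type) ι₁) j
  · haveI : IsEmpty (NegIdx (cmXW (L : Type) (frameD V) (dW S) (dW_real S) ι₁ (cmPlace (L : Type) ι₁))) := ⟨fun s => s.2 (hR s.1)⟩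
    have hG := mem_span_detZ_of_kV_det_eigen (iotaFrameA (L : Type) (frameD V) (frameD_real V) ι₁ (frameD_sign_ι₁ V)) (posReadingEquiv hR)
      (iotaQ₀ (L : Type) (frameD V) (frameD_real V) ι₁ (frameD_sign_ι₁ V)) (rename (pinPairFrame V S (cmPlace (L : Type) ι₁)) p)
      (fun A D => by rw [hx A D, dVIota_eq_det_of_pos V S hR])
    have hj : jIAt (L : Type) (frameD V) (frameD_real V) (dW S) (dW_real S) ι₁ (frameD_sign_ι₁ V) hW =
        (pinPairFrame V S (cmPlace (L : Type) ι₁)).symm ∘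
          planeToDPIdx (iotaFrameA (L : Type) (frameD V) (frameD_real V) ι₁ (frameD_sign_ι₁ V)) (posReadingEquiv hR)
            (iotaQ₀ (L : Type) (frameD V) (frameD_real V) ι₁ (frameD_sign_ι₁ V))
            (NegIdx (cmXW (L : Type) (frameD V) (dW S) (dW_real S) ι₁ (cmPlace (L : Type) ι₁))) := by
      unfold jIAt; rw [dif_pos hR]
    obtain ⟨c, hc⟩ := Submodule.mem_span_singleton.mp hG
    have hp' : p = c • rename (jIAt (L : Type) (frameD V) (frameD_real V) (dW S) (dW_real S) ι₁ (frameD_sign_ι₁ V) hW)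
        HodgeCM.PerL34.Fock.detZ := by
      rw [hj, ← rename_rename, ← map_smul, hc]
      exact eq_rename_symm_rename V S _ p
    rw [hp']
    exact Submodule.smul_mem _ _ (Submodule.mem_span_singleton_self _)
  · have hS : ∀ j, ¬0 < cmXW (L : Type) (frameD V) (dW S) (dW_real S) ι₁ (cmPlace (L : Type) ι₁) j :=
      (cmXW_cmPlace_pos_or_neg (L : Type) (frameD V) (dW S) (dW_real S) ι₁ hW).resolve_left hR
    haveI : IsEmpty (PosIdx (cmXW (L : Type) (frameD V) (dW S) (dW_real S) ι₁ (cmPlace (L : Type) ι₁))) := ⟨fun r => hS r.1 r.2⟩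
    have hG := mem_span_detZ_of_kV_det_eigen_neg (iotaFrameA (L : Type) (frameD V) (frameD_real V) ι₁ (frameD_sign_ι₁ V))
      (negReadingEquiv hS) (iotaQ₀ (L : Type) (frameD V) (frameD_real V) ι₁ (frameD_sign_ι₁ V))
      (rename (pinPairFrame V S (cmPlace (L : Type) ι₁)) p) (fun A D => by rw [hx A D, dVIota_eq_det_of_neg V S hR])
    have hj : jIAt (L : Type) (frameD V) (frameD_real V) (dW S) (dW_real S) ι₁ (frameD_sign_ι₁ V) hW =
        (pinPairFrame V S (cmPlace (L : Type) ι₁)).symm ∘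
          planeToDPIdxS (iotaFrameA (L : Type) (frameD V) (frameD_real V) ι₁ (frameD_sign_ι₁ V)) (negReadingEquiv hS)
            (iotaQ₀ (L : Type) (frameD V) (frameD_real V) ι₁ (frameD_sign_ι₁ V))
            (PosIdx (cmXW (L : Type) (frameD V) (dW S) (dW_real S) ι₁ (cmPlace (L : Type) ι₁))) := by
      unfold jIAt; rw [dif_neg hR]
    obtain ⟨c, hc⟩ := Submodule.mem_span_singleton.mp hG
    have hp' : p = c • rename (jIAt (L : Type) (frameD V) (frameD_real V) (dW S) (dW_real S) ι₁ (frameD_sign_ι₁ V) hW)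
        HodgeCM.PerL34.Fock.detZ := by
      rw [hj, ← rename_rename, ← map_smul, hc]
      exact eq_rename_symm_rename V S _ p
    rw [hp']
    exact Submodule.smul_mem _ _ (Submodule.mem_span_singleton_self _)

/-- **a `Σ₁₂` place with `V` read positive.** -/
theorem mem_range_embOf_of_sigmaPos (b : InfinitePlace (L : Type)) (hb : cmPlacesEquiv (L : Type) b ≠ cmPlace (L : Type) ι₁)
    (hsig : Nonempty (PosIdx (cmXW (L : Type) (frameD V) (dW S) (dW_real S) ι₁ (cmPlacesEquiv (L : Type) b))) ∧
      Nonempty (NegIdx (cmXW (L : Type) (frameD V) (dW S) (dW_real S) ι₁ (cmPlacesEquiv (L : Type) b))))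
    (hQ : IsEmpty (NegIdx (cmXV (L : Type) (frameD V) (frameD_real V) ι₁ (cmPlacesEquiv (L : Type) b))))
    {p : MvPolynomial (Fin 6) ℂ}
    (hp : p ∈ jointEigenspace (fun a : VLetterFam V => (pinPlaceOp V S (cmPlacesEquiv (L : Type) b) a).toLinearMap)
      (pinPlaceEig V S (cmPlacesEquiv (L : Type) b))) :
    p ∈ LinearMap.range (embOf (L : Type) (frameD V) (frameD_real V) (dW S) (dW_real S) ι₁ (datumAtσ V S jD (jIOf V S hW) σ) m₁ m₂ b) := by
  haveI := hQ
  have hsub := subsingleton_posIdx_negIdx_two hsig.1 hsig.2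
  haveI := hsub.1
  haveI := hsub.2
  letI : Unique (PosIdx (cmXW (L : Type) (frameD V) (dW S) (dW_real S) ι₁ (cmPlacesEquiv (L : Type) b))) :=
    uniqueOfSubsingleton (Classical.choice hsig.1)
  letI : Unique (NegIdx (cmXW (L : Type) (frameD V) (dW S) (dW_real S) ι₁ (cmPlacesEquiv (L : Type) b))) :=
    uniqueOfSubsingleton (Classical.choice hsig.2)
  haveI : Nonempty (PosIdx (cmXV (L : Type) (frameD V) (frameD_real V) ι₁ (cmPlacesEquiv (L : Type) b))) :=
    ⟨((cmEpsV (L : Type) (frameD V) (frameD_real V) ι₁ (cmPlacesEquiv (L : Type) b)).trans (@Equiv.sumEmpty _ _ hQ)) 0⟩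
  have hinv : ∀ a : Matrix.unitaryGroup (PosIdx (cmXV (L : Type) (frameD V) (frameD_real V) ι₁ (cmPlacesEquiv (L : Type) b))) ℂ,
      linSubst (star ((dualPairι (((a, (1 : Matrix.unitaryGroup (NegIdx (cmXV (L : Type) (frameD V) (frameD_real V) ι₁
          (cmPlacesEquiv (L : Type) b))) ℂ)), (1, 1)) :
          DPK (PosIdx (cmXV (L : Type) (frameD V) (frameD_real V) ι₁ (cmPlacesEquiv (L : Type) b)))
            (NegIdx (cmXV (L : Type) (frameD V) (frameD_real V) ι₁ (cmPlacesEquiv (L : Type) b)))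
            (PosIdx (cmXW (L : Type) (frameD V) (dW S) (dW_real S) ι₁ (cmPlacesEquiv (L : Type) b)))
            (NegIdx (cmXW (L : Type) (frameD V) (dW S) (dW_real S) ι₁ (cmPlacesEquiv (L : Type) b)))) :
          Matrix.unitaryGroup _ ℂ) : Matrix _ _ ℂ)) (rename (pinPairFrame V S (cmPlacesEquiv (L : Type) b)) p) =
        rename (pinPairFrame V S (cmPlacesEquiv (L : Type) b)) p := fun a => by
    have := linSubst_dualPairι_framePoly V S (cmPlacesEquiv (L : Type) b) hp (a, 1)
    rwa [Pi.mulSingle_eq_of_ne (Ne.symm hb), dVIota_one, one_smul] at this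
  have hG := (kV_invariant_iff_mem_span_slotPairing_pow (Classical.choice hsig.1) (Classical.choice hsig.2) _).mp hinv
  -- the two (T12) orientations share the variable identification `idx`; prove the span membership once
  suffices key : p ∈ Submodule.span ℂ (Set.range fun k : ℕ => rename ((PlaceDatum.sigmaPos ((cmEpsV (L : Type) (frameD V) (frameD_real V) ι₁
        (cmPlacesEquiv (L : Type) b)).trans (@Equiv.sumEmpty _ _ hQ)) hQ (Classical.choice hsig.1) (Classical.choice hsig.2) hsub.1 hsub.2 :
          PlaceDatum (L : Type) (frameD V) (frameD_real V) (dW S) (dW_real S) ι₁ (cmPlacesEquiv (L : Type) b)).idx)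
        (HodgeCM.PerL34.Fock.P ^ k)) by
    by_cases hr : σ b (Classical.choice hsig.1).1 = 0
    · exact mem_range_emb_of_eq_sigmaPos (L : Type) (frameD V) (frameD_real V) (dW S) (dW_real S) ι₁ _ _ hQ _ _ hsub.1 hsub.2 _
        (datumAt_of_sigmaPos V S jD (jIOf V S hW) b hb hsig hQ hr) _ p key
    · exact mem_range_emb_of_eq_sigmaPosSwap (L : Type) (frameD V) (frameD_real V) (dW S) (dW_real S) ι₁ _ _ hQ _ _ hsub.1 hsub.2 _
        (datumAt_of_sigmaPosSwap V S jD (jIOf V S hW) b hb hsig hQ hr) _ p key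
  have hidx : ((PlaceDatum.sigmaPos ((cmEpsV (L : Type) (frameD V) (frameD_real V) ι₁ (cmPlacesEquiv (L : Type) b)).trans
      (@Equiv.sumEmpty _ _ hQ)) hQ (Classical.choice hsig.1) (Classical.choice hsig.2) hsub.1 hsub.2 :
        PlaceDatum (L : Type) (frameD V) (frameD_real V) (dW S) (dW_real S) ι₁ (cmPlacesEquiv (L : Type) b)).idx :
      HodgeCM.PerL34.Fock.MixedVar → Fin 6) =
      (pinPairFrame V S (cmPlacesEquiv (L : Type) b)).symm ∘
        mixedToDPIdx (NegIdx (cmXV (L : Type) (frameD V) (frameD_real V) ι₁ (cmPlacesEquiv (L : Type) b)))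
          ((cmEpsV (L : Type) (frameD V) (frameD_real V) ι₁ (cmPlacesEquiv (L : Type) b)).trans (@Equiv.sumEmpty _ _ hQ))
          (Classical.choice hsig.1) (Classical.choice hsig.2) := by
    funext x
    change (cmIdx (L : Type) (frameD V) (frameD_real V) (dW S) (dW_real S) ι₁ (cmPlacesEquiv (L : Type) b)).symm (mixedToDPIdx _ _ _ _ x) = _
    rw [cmIdx_eq_pairFrame]
    rfl
  have hle : (Submodule.span ℂ (Set.range fun k : ℕ => slotPairing (Q' := NegIdx (cmXV (L : Type) (frameD V) (frameD_real V) ι₁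
      (cmPlacesEquiv (L : Type) b))) (Classical.choice hsig.1) (Classical.choice hsig.2) ^ k)).map
      (rename (pinPairFrame V S (cmPlacesEquiv (L : Type) b)).symm).toLinearMap ≤
      Submodule.span ℂ (Set.range fun k : ℕ => rename ((PlaceDatum.sigmaPos ((cmEpsV (L : Type) (frameD V) (frameD_real V) ι₁
        (cmPlacesEquiv (L : Type) b)).trans (@Equiv.sumEmpty _ _ hQ)) hQ (Classical.choice hsig.1) (Classical.choice hsig.2) hsub.1 hsub.2 :
          PlaceDatum (L : Type) (frameD V) (frameD_real V) (dW S) (dW_real S) ι₁ (cmPlacesEquiv (L : Type) b)).idx)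
        (HodgeCM.PerL34.Fock.P ^ k)) := by
    rw [Submodule.map_span, ← Set.range_comp]
    refine le_of_eq (congrArg _ (congrArg _ (funext fun k => ?_)))
    rw [Function.comp_apply, AlgHom.toLinearMap_apply]
    refine Eq.trans ?_ (congrArg (fun j => rename j (HodgeCM.PerL34.Fock.P ^ k)) hidx).symm
    rw [← rename_rename, map_pow, map_pow, rename_mixedToDPIdx_P, map_pow]
    rfl
  rw [eq_rename_symm_rename V S (cmPlacesEquiv (L : Type) b) p]
  exact hle (Submodule.mem_map_of_mem hG)

end Range

end HodgeCM.Model.HypCensus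

end
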